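import Literature.AnabelianGeometry.AbsoluteAnabelian.AbsTopII.TwoTripodNodalInertia
import Literature.AnabelianGeometry.AbsoluteAnabelian.AbsTopII.InertiaGroupsBranchScope
import HarnessLib

/-!
# [AbsTopII] Prop 1.3 (ii)′ and (iv)′ at the two-vertex nodal DPSC datum — `I_e = Π_e · T`, `T ∩ γUγ⁻¹ = 1`

S. Mochizuki, *Topics in Absolute Anabelian Geometry II* [AbsTopII] (bib `MochizukiAbsTopII2013`; locators =
PDF pages of the kurims manuscript `paper:url-585b8d0ad0d9`), §1 Prop 1.3 (ii) p. 11, (iv) pp. 11–12 (proof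
pp. 12–15); [CombGC] (`MochizukiCombGC2007`) Prop 1.2 (ii) p. 8.

PROOF-ONLY companion of `AbsTopII/TwoTripodNodalDatum.lean` (abc-iut-f-066 gen 5, row «P13-TWO-VERTEX-NODAL-MODEL»),
part 2/3.  At `M.dpsc` (two tripods `v_A`, `v_B`, ONE non-loop node `e`, `I ≅ Ẑ^Σ` acting by the Dehn
twist; every `Σ`; `I_{v_A} = T`, `I_{v_B} = U` from `TwoTripodNodalInertia.lean`):

* `prop_1_3_ii'_dpsc` — **Prop 1.3 (ii) with the printed branch pair (`Prop_1_3_ii'`) HOLDS at a NON-LOOP node,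
  no hypothesis**: `I_e = Π_e · T ≅ Ẑ^Σ × Ẑ^Σ` (abc-iut-f-069's `IvNode_eq_of_image` / abc-iut-w5-d102's
  `prop_1_3_ii'_of_inputs`), and for the branch pair `(v_A, v_B)`: `I_{v_A} × I_{v_B} = T × U ⥲ I_e`, open of
  index `1 = i^Σ_e` (`T ∩ U = {1}` by the two-character lemma of part XI; `T · U = Π_e · T` since
  `ι(inl c₁c₂) = ι(inr 1) · u⁻¹`);
* `prop13iv'_dpsc` — **Prop 1.3 (iv) trichotomy + «In particular» (`Prop13iv'`) with two ADJACENT vertices**;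
  the «In particular» clause `I_{v_A} ∩ γ I_{v_B} γ⁻¹ = {1}` for EVERY `γ` is the two-character lemma with the
  `φ`-invariant character `c₁ ↦ 1, c₁c₂ ↦ 1, c₃ ↦ −1` of `Γ_{0,4}`;
* the (iv) «Moreover» clause and the summary theorem are in `AbsTopII/TwoTripodNodalMoreover.lean` (3/3).

Convention: group theory with subgroups of `P` (`W := ι(Π_e)`, `T`, `U`); transfer to `M.dpsc` is definitional.
HONEST FRAMING: instance at a constructed datum (constructed ≠ geometric); no hypothesis; no side taken on
[IUTchIII] Cor 3.12; typed ≠ proved for the print statements about all stable log curves.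
-/

noncomputable section

open scoped Pointwise

namespace Literature.AnabelianGeometry.AbsoluteAnabelian.AbsTopII.TwoTripodNodal.Model

open Literature.AnabelianGeometry.SemiGraphs
open Literature.AnabelianGeometry.SemiGraphs.SemiGraphOfAnabelioids (IsProSigmaCompletion)
open Literature.AnabelianGeometry.SemiGraphs.SemiGraphOfAnabelioids.IsProSigmaCompletion
open Literature.AnabelianGeometry.Anabelioids (IsSigmaInteger normalizer_le_commensurator)
open Literature.GroupTheory.CombinatorialGroupTheory
open Literature.GroupTheory.CombinatorialGroupTheory.PuncturedSurfaceGroup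
open _root_.Topology

variable {Sigma : Set ℕ} (M : Model Sigma)

/-! ### Small helpers -/

/-- A closed cyclic subgroup whose generator commutes with `t` centralises `t`. [cite: MochizukiAbsTopII2013, Prop 1.3 (ii) p.11] -/
theorem zpowers_closure_le_centralizer (x t : M.P) (h : x * t = t * x) :
    (Subgroup.zpowers x).topologicalClosure ≤ Subgroup.centralizer ({t} : Set M.P) := by
  refine Subgroup.topologicalClosure_minimal _ ?_ (Set.isClosed_centralizer _)
  rw [Subgroup.zpowers_le, Subgroup.mem_centralizer_singleton_iff]
  exact h

/-- Two closed subgroups of `P` that commute elementwise generate a CLOSED subgroup with carrier the product set.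
[cite: MochizukiAbsTopII2013, Prop 1.3 (ii) p.11] -/
theorem isClosed_sup_of_commute {A B : Subgroup M.P} (hA : IsClosed (A : Set M.P)) (hB : IsClosed (B : Set M.P))
    (h : ∀ a ∈ A, ∀ b ∈ B, a * b = b * a) :
    ((A ⊔ B : Subgroup M.P) : Set M.P) = (A : Set M.P) * B ∧ IsClosed ((A ⊔ B : Subgroup M.P) : Set M.P) := by
  have hle : A ≤ Subgroup.normalizer (B : Set M.P) := fun a ha => by
    rw [Subgroup.mem_normalizer_iff]
    intro k
    constructor
    · intro hk; rwa [h a ha k hk, mul_inv_cancel_right]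
    · intro hk
      have hc := h a ha _ hk
      have hk' : k = a * k * a⁻¹ := by
        calc k = a⁻¹ * ((a * k * a⁻¹) * a) := by group
          _ = a⁻¹ * (a * (a * k * a⁻¹)) := by rw [← hc]
          _ = a * k * a⁻¹ := by rw [inv_mul_cancel_left]
      rw [hk']; exact hk
  have hcoe : ((A ⊔ B : Subgroup M.P) : Set M.P) = (A : Set M.P) * B :=
    Subgroup.coe_mul_of_left_le_normalizer_right A B hle
  exact ⟨hcoe, hcoe ▸ (hA.isCompact.mul hB.isCompact).isClosed⟩

/-- Every node abuts to every vertex (the graph is `v_A — e — v_B`). [cite: MochizukiAbsTopII2013, Ex 1.1 (ii) p.9] -/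
theorem nodeAbuts_dpsc (hne : Sigma.Nonempty) (hprime : ∀ p ∈ Sigma, p.Prime) (e : (M.dpsc hne hprime).Node) (v : (M.dpsc hne hprime).Vert) :
    (M.dpsc hne hprime).nodeAbuts e v := by
  rcases v with ⟨v⟩
  change v ∈ s((0 : Fin 2), (1 : Fin 2))
  fin_cases v
  · exact Sym2.mem_mk_left _ _
  · exact Sym2.mem_mk_right _ _

/-- Any two vertices are adjacent. [cite: MochizukiAbsTopII2013, Prop 1.3 (iv) p.11] -/
theorem adjacent_dpsc (hne : Sigma.Nonempty) (hprime : ∀ p ∈ Sigma, p.Prime) (v v' : (M.dpsc hne hprime).Vert) : (M.dpsc hne hprime).Adjacent v v' :=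
  ⟨⟨()⟩, M.nodeAbuts_dpsc hne hprime _ v, M.nodeAbuts_dpsc hne hprime _ v'⟩

/-- `⟨0⟩ ≠ ⟨1⟩` in the vertex type. [cite: MochizukiAbsTopII2013, Ex 1.1 (ii) p.9] -/
theorem vert_zero_ne_one (hne : Sigma.Nonempty) (hprime : ∀ p ∈ Sigma, p.Prime) : (⟨(0 : Fin 2)⟩ : (M.dpsc hne hprime).Vert) ≠ ⟨(1 : Fin 2)⟩ := fun h => by
  have := congrArg ULift.down h
  change (0 : Fin 2) = 1 at this
  exact absurd this (by decide)

/-- `Π_e ≤ Π_v` for both vertices (the node lies on both components). [cite: MochizukiAbsTopII2013, Def 1.2 (ii) p.10] -/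
theorem nodeSub_le_vertSub (hne : Sigma.Nonempty) (hprime : ∀ p ∈ Sigma, p.Prime) (e : (M.dpsc hne hprime).Node) (v : (M.dpsc hne hprime).Vert) :
    (M.dpsc hne hprime).nodeSub e ≤ (M.dpsc hne hprime).vertSub v := by
  rcases M.vert_cases hne hprime v with rfl | rfl
  · exact Subgroup.map_mono (Subgroup.topologicalClosure_mono (Subgroup.map_mono
      ((Subgroup.zpowers_le (g := (c 1 * c 2 : PuncturedSurfaceGroup 0 4))).mpr node_mem_closureA)))
  · exact Subgroup.map_mono (Subgroup.topologicalClosure_mono (Subgroup.map_mono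
      ((Subgroup.zpowers_le (g := (c 1 * c 2 : PuncturedSurfaceGroup 0 4))).mpr node_mem_closureB)))

/-- `I_v ≤ I_e` for both vertices (centralisers are antitone). [cite: MochizukiAbsTopII2013, Prop 1.3 (ii) p.11] -/
theorem Iv_le_IvNode (hne : Sigma.Nonempty) (hprime : ∀ p ∈ Sigma, p.Prime) (e : (M.dpsc hne hprime).Node) (v : (M.dpsc hne hprime).Vert) :
    (M.dpsc hne hprime).Iv v ≤ (M.dpsc hne hprime).IvNode e :=
  inf_le_inf_right _ (Subgroup.centralizer_le (M.nodeSub_le_vertSub hne hprime e v))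

/-! ### The image `J = W · T`, `W := ι(Π_e)` -/

/-- `T` centralises `W = closure ⟨ι(inl c₁c₂)⟩`. [cite: MochizukiAbsTopII2013, Prop 1.3 (ii) p.11] -/
theorem W_commute_T : ∀ a ∈ (M.nodeGp).map M.PiG.subtype, ∀ t ∈ M.T, a * t = t * a := by
  intro a ha t ht
  rw [nodeGp_map_eq] at ha
  have hle := M.zpowers_closure_le_centralizer _ t
    (SemidirectCofinal.centralizes_of_fixed M.φ M.ι M.twist_node ht).symm
  exact Subgroup.mem_centralizer_singleton_iff.mp (hle ha)

/-- `W` is closed in `P`. [cite: MochizukiAbsTopII2013, Def 1.2 (ii) p.10] -/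
theorem isClosed_W : IsClosed (((M.nodeGp).map M.PiG.subtype : Subgroup M.P) : Set M.P) := by
  rw [nodeGp_map_eq]; exact Subgroup.isClosed_topologicalClosure _

/-- `J := W ⊔ T` is closed. [cite: MochizukiAbsTopII2013, Prop 1.3 (ii) p.11] -/
theorem isClosed_WT : IsClosed ((((M.nodeGp).map M.PiG.subtype ⊔ M.T : Subgroup M.P)) : Set M.P) :=
  (M.isClosed_sup_of_commute M.isClosed_W (Subgroup.isClosed_topologicalClosure _) M.W_commute_T).2

/-- `c₁c₂` has infinite order (its image under the character `b_j ↦ 1` is `1 ∈ ℤ`). [cite: MochizukiSemiAnbd2006, Ex. 2.10 p.31] -/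
theorem not_isOfFinOrder_node : ¬ IsOfFinOrder (c 1 * c 2 : PuncturedSurfaceGroup 0 4) := by
  obtain ⟨b, hb0, hb1, hb2⟩ := exists_freeGroupBasis_node
  let χ : PuncturedSurfaceGroup 0 4 →* Multiplicative ℤ := b.lift fun _ => Multiplicative.ofAdd (1 : ℤ)
  have hχ : χ (c 1 * c 2) = Multiplicative.ofAdd (1 : ℤ) := by
    rw [← hb1]
    change FreeGroup.lift (fun _ => Multiplicative.ofAdd (1 : ℤ)) (b.repr (b 1)) = _
    rw [FreeGroupBasis.repr_apply_coe, FreeGroup.lift_apply_of]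
  intro h
  have h1 := χ.isOfFinOrder h
  rw [hχ, isOfFinOrder_iff_pow_eq_one] at h1
  obtain ⟨n, hn, hn1⟩ := h1
  rw [← ofAdd_nsmul, nsmul_eq_mul, mul_one] at hn1
  have h0 : (n : ℤ) = 0 := Multiplicative.ofAdd.injective (by rw [hn1, ofAdd_zero])
  omega

/-- **`W ≅ Ẑ^Σ`**: the nodal subgroup is free pro-`Σ`-cyclic (the closure of the rank-one free factor `⟨c₁c₂⟩` is
its pro-`Σ` completion, Ribes–Zalesskii 9.1.12; a completion of an infinite cyclic group is `≅ Ẑ^Σ`).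
[cite: MochizukiCombGC2007, Rmk 1.1.3 p.7] -/
theorem isFreeProSigmaCyclic_W : IsFreeProSigmaCyclic Sigma ↥((M.nodeGp).map M.PiG.subtype) := by
  obtain ⟨b, hb0, hb1, hb2⟩ := exists_freeGroupBasis_node
  haveI : CompactSpace ↥M.PiG := isCompact_iff_compactSpace.mp M.isClosed_PiG.isCompact
  have hS : Subgroup.closure (b '' {1}) = Subgroup.zpowers (c 1 * c 2 : PuncturedSurfaceGroup 0 4) := by
    rw [Set.image_singleton, hb1, Subgroup.zpowers_eq_closure]
  have hA : ((Subgroup.closure (b '' {1})).map M.κG).topologicalClosure = M.nodeGp := by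
    rw [hS]; rfl
  have hκ := freeFactor_isProSigmaCompletion b {1} M.isProSigmaCompletion_κG
  obtain ⟨e₀, -⟩ := exists_mulEquiv_zpowers_of_not_isOfFinOrder not_isOfFinOrder_node
  let e₁ : Multiplicative ℤ ≃* ↥(Subgroup.closure (b '' ({1} : Set (Fin 3)))) :=
    e₀.trans (MulEquiv.subgroupCongr hS.symm)
  have hfree : IsFreeProSigmaCyclic Sigma ↥(((Subgroup.closure (b '' {1})).map M.κG).topologicalClosure) :=
    isFreeProSigmaCyclic_of_isProSigmaCompletion_of_mulEquiv e₁ hκ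
  rw [hA] at hfree
  obtain ⟨f, -⟩ := DPSCIndexData.exists_subgroupEquiv_ofEmbedding M.P M.PiG.subtype continuous_subtype_val
    Subtype.val_injective (K := M.nodeGp) (Subgroup.isClosed_topologicalClosure _)
  exact hfree.of_continuousMulEquiv f

/-- **`J = W · T` is an internal product `W × T`** (`W ∩ T ⊆ Π_𝔾 ∩ T = {1}`).
[cite: MochizukiAbsTopII2013, Prop 1.3 (ii) p.11] -/
theorem isInternalProduct_WT :
    IsInternalProduct ((M.nodeGp).map M.PiG.subtype) M.T ((M.nodeGp).map M.PiG.subtype ⊔ M.T) := by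
  refine ⟨le_sup_left, le_sup_right, M.W_commute_T, ?_, rfl⟩
  have h := SemidirectCofinal.closure_inr_inf_closure_inl_eq_bot M.φ (P := M.P) M.isProSigmaCompletion
  rw [eq_bot_iff]
  rintro x ⟨hxW, hxT⟩
  have hxG : x ∈ M.PiG := Subgroup.map_subtype_le _ hxW
  have : x ∈ M.T ⊓ M.PiG := ⟨hxT, hxG⟩
  rw [Model.T, Model.PiG, h] at this
  exact this

/-- `J · Π_𝔾 = P` (through `T · Π_𝔾 = P`). [cite: MochizukiAbsTopII2013, Prop 1.3 (ii) p.11] -/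
theorem WT_sup_PiG : (M.nodeGp).map M.PiG.subtype ⊔ M.T ⊔ M.PiG.subtype.range = ⊤ := by
  rw [Subgroup.range_subtype, eq_top_iff, ← M.PiG_sup_T]
  exact sup_le (le_sup_right) (le_trans le_sup_right le_sup_left)

/-! ### [CombGC] Prop 1.2 (ii) in DPSC form; `I_e = J` -/

/-- `Π_e` is commensurably terminal in `Π_𝔾` (two-tripod shape, through the presentation of the embedded datum).
[cite: MochizukiCombGC2007, Prop 1.2(ii) p.8] -/
theorem isCommensurablyTerminal_nodeSub (hne : Sigma.Nonempty) (hprime : ∀ p ∈ Sigma, p.Prime) (e : (M.dpsc hne hprime).Node) :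
    IsCommensurablyTerminal (((M.dpsc hne hprime).nodeSub e).subgroupOf (M.dpsc hne hprime).PiG) := by
  haveI : CompactSpace ↥M.PiG := isCompact_iff_compactSpace.mp M.isClosed_PiG.isCompact
  obtain ⟨e', he'⟩ := DPSCData.exists_rangeEquiv (M.pscDatum hne hprime) M.P M.PiG.subtype M.isClosed_range_subtype
    M.normal_range_subtype ⊤ inferInstance le_top continuous_subtype_val Subtype.val_injective
  exact (M.dpsc hne hprime).toDPSCData.isCommensurablyTerminal_nodeSub_of_psc
    ((M.pscDatum hne hprime).mapAlong e'.toMulEquiv.toMonoidHom e'.continuous (M.pscDatum hne hprime).Sigma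
      subset_rfl (M.pscDatum hne hprime).sigma_nonempty ((M.pscDatum hne hprime).proSigma.of_continuousMulEquiv e'))
    Equiv.ulift (DPSCData.nodeSub_presentation (M.pscDatum hne hprime) M.P M.PiG.subtype M.isClosed_range_subtype
      M.normal_range_subtype ⊤ inferInstance le_top he')
    ((PSCDatum.verticialEdgeLikeCommensurablyTerminal_mapAlong_equiv_iff (M.pscDatum hne hprime) e' _ _ _ _).mpr
      (M.verticialEdgeLikeCommensurablyTerminal_pscDatum hne hprime)) e

/-- `Π_v` is commensurably terminal in `Π_𝔾`. [cite: MochizukiCombGC2007, Prop 1.2(ii) p.8] -/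
theorem isCommensurablyTerminal_vertSub (hne : Sigma.Nonempty) (hprime : ∀ p ∈ Sigma, p.Prime) (v : (M.dpsc hne hprime).Vert) :
    IsCommensurablyTerminal (((M.dpsc hne hprime).vertSub v).subgroupOf (M.dpsc hne hprime).PiG) := by
  haveI : CompactSpace ↥M.PiG := isCompact_iff_compactSpace.mp M.isClosed_PiG.isCompact
  obtain ⟨e', he'⟩ := DPSCData.exists_rangeEquiv (M.pscDatum hne hprime) M.P M.PiG.subtype M.isClosed_range_subtype
    M.normal_range_subtype ⊤ inferInstance le_top continuous_subtype_val Subtype.val_injective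
  exact (M.dpsc hne hprime).toDPSCData.isCommensurablyTerminal_vertSub_of_psc
    ((M.pscDatum hne hprime).mapAlong e'.toMulEquiv.toMonoidHom e'.continuous (M.pscDatum hne hprime).Sigma
      subset_rfl (M.pscDatum hne hprime).sigma_nonempty ((M.pscDatum hne hprime).proSigma.of_continuousMulEquiv e'))
    Equiv.ulift (DPSCData.vertSub_presentation (M.pscDatum hne hprime) M.P M.PiG.subtype M.isClosed_range_subtype
      M.normal_range_subtype ⊤ inferInstance le_top he')
    ((PSCDatum.verticialEdgeLikeCommensurablyTerminal_mapAlong_equiv_iff (M.pscDatum hne hprime) e' _ _ _ _).mpr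
      (M.verticialEdgeLikeCommensurablyTerminal_pscDatum hne hprime)) v

/-- **`I_e = J = W · T`** (abc-iut-f-069's «`Im(Π^Σ_ν) = I_e`»). [cite: MochizukiAbsTopII2013, Prop 1.3 (ii) p.11] -/
theorem IvNode_eq_J (hne : Sigma.Nonempty) (hprime : ∀ p ∈ Sigma, p.Prime) (e : (M.dpsc hne hprime).Node) :
    (M.dpsc hne hprime).IvNode e = (M.nodeGp).map M.PiG.subtype ⊔ M.T :=
  (M.dpsc hne hprime).toDPSCData.IvNode_eq_of_image e (M.isCommensurablyTerminal_nodeSub hne hprime e)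
    le_sup_left M.WT_sup_PiG
    (M.isInternalProduct_WT.comm_of_comm M.isFreeProSigmaCyclic_W.subgroup_comm M.isFreeProSigmaCyclic_T.subgroup_comm)

/-! ### `T` and `U`: disjoint, commuting, generating `J` -/

/-- A `φ`-invariant character of `Γ_{0,4}` with `f((c₁c₂)⁻¹) = −1`: `c₁ ↦ 1`, `c₁c₂ ↦ 1`, `c₃ ↦ −1` on the
Nielsen basis. [cite: MochizukiAbsTopII2013, Prop 1.3 (iv) p.11] -/
theorem exists_invariant_character :
    ∃ f : PuncturedSurfaceGroup 0 4 →* Multiplicative ℤ,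
      (∀ (g : Multiplicative ℤ) (x : PuncturedSurfaceGroup 0 4), f (M.φ g x) = f x) ∧
        f (c 1 * c 2 : PuncturedSurfaceGroup 0 4)⁻¹ = (Multiplicative.ofAdd (1 : ℤ))⁻¹ := by
  obtain ⟨b, hb0, hb1, hb2⟩ := exists_freeGroupBasis_node
  let v : Fin 3 → Multiplicative ℤ := fun j => if j = 2 then (Multiplicative.ofAdd (1 : ℤ))⁻¹ else Multiplicative.ofAdd 1
  let f : PuncturedSurfaceGroup 0 4 →* Multiplicative ℤ := b.lift v
  have hf : ∀ j, f (b j) = v j := fun j => by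
    change FreeGroup.lift v (b.repr (b j)) = v j
    rw [FreeGroupBasis.repr_apply_coe, FreeGroup.lift_apply_of]
  -- invariance under `φ(1)`, checked on the basis
  have h1 : f.comp (M.φ (Multiplicative.ofAdd (1 : ℤ))).toMonoidHom = f := by
    refine b.ext_hom _ _ fun j => ?_
    rw [MonoidHom.comp_apply, MulEquiv.coe_toMonoidHom]
    fin_cases j
    · change f (M.φ _ (b 0)) = f (b 0)
      rw [hb0, M.twist_c_one]
    · change f (M.φ _ (b 1)) = f (b 1)
      rw [hb1, M.twist_node]
    · change f (M.φ _ (b 2)) = f (b 2)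
      rw [hb2, M.twist_c_three, map_mul, map_mul, map_inv, mul_inv_cancel_comm]
  refine ⟨f, fun g x => ?_, ?_⟩
  · -- invariance under every `φ g`: the stabiliser of `f` is a subgroup containing the generator
    let S : Subgroup (Multiplicative ℤ) :=
      { carrier := {g | ∀ x, f (M.φ g x) = f x}
        one_mem' := fun x => by simp
        mul_mem' := fun {a b} ha hb x => by
          change f (M.φ (a * b) x) = f x
          rw [map_mul, MulAut.mul_apply, ha, hb]
        inv_mem' := fun {a} ha x => by
          change f (M.φ a⁻¹ x) = f x
          have := ha (M.φ a⁻¹ x)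
          rw [map_inv, MulAut.apply_inv_self] at this
          rw [map_inv]
          exact this.symm }
    have hmem : Multiplicative.ofAdd (1 : ℤ) ∈ S := fun x => DFunLike.congr_fun h1 x
    have hle : Subgroup.zpowers (Multiplicative.ofAdd (1 : ℤ)) ≤ S := (Subgroup.zpowers_le).mpr hmem
    have hg : g ∈ Subgroup.zpowers (Multiplicative.ofAdd (1 : ℤ)) :=
      ⟨Multiplicative.toAdd g, by
        change Multiplicative.ofAdd (1 : ℤ) ^ Multiplicative.toAdd g = g
        rw [← ofAdd_zsmul, smul_eq_mul, mul_one, ofAdd_toAdd]⟩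
    exact hle hg x
  · rw [map_inv, ← hb1, hf]
    simp [v]

/-- **`T ∩ γ U γ⁻¹ = {1}` and `U ∩ γ T γ⁻¹ = {1}` for every `γ ∈ P`** (part XI two-character lemma).
[cite: MochizukiAbsTopII2013, Prop 1.3 (iv) p.12] -/
theorem T_inf_conj_U (γ : M.P) : M.T ⊓ MulAut.conj γ • M.U = ⊥ ∧ M.U ⊓ MulAut.conj γ • M.T = ⊥ := by
  obtain ⟨f, hf, hδ⟩ := M.exists_invariant_character
  exact SemidirectCofinal.closure_inr_inf_conj_closure_zpowers_eq_bot M.φ M.isProSigmaCompletion f hf _ hδ γ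

/-- `T` and `U` commute elementwise (`u = ι(inl (c₁c₂)⁻¹)·ι(inr 1)`: the first factor is twist-fixed, the second lies
in the abelian `T`). [cite: MochizukiAbsTopII2013, Prop 1.3 (ii) p.11] -/
theorem T_commute_U : ∀ t ∈ M.T, ∀ u ∈ M.U, t * u = u * t := by
  intro t ht u hu
  have hinr : M.ι (SemidirectProduct.inr (Multiplicative.ofAdd (1 : ℤ))) ∈ M.T :=
    Subgroup.le_topologicalClosure _ ⟨_, ⟨Multiplicative.ofAdd (1 : ℤ), rfl⟩, rfl⟩
  have hgen : M.ι (SemidirectProduct.inl (c 1 * c 2 : PuncturedSurfaceGroup 0 4)⁻¹ *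
      SemidirectProduct.inr (Multiplicative.ofAdd (1 : ℤ))) * t =
        t * M.ι (SemidirectProduct.inl (c 1 * c 2 : PuncturedSurfaceGroup 0 4)⁻¹ *
          SemidirectProduct.inr (Multiplicative.ofAdd (1 : ℤ))) := by
    have hfix : M.φ (Multiplicative.ofAdd (1 : ℤ)) (c 1 * c 2 : PuncturedSurfaceGroup 0 4)⁻¹ = (c 1 * c 2)⁻¹ := by
      rw [map_inv, M.twist_node]
    have h1 := SemidirectCofinal.centralizes_of_fixed M.φ M.ι hfix ht
    have h2 : t * M.ι (SemidirectProduct.inr (Multiplicative.ofAdd (1 : ℤ))) =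
        M.ι (SemidirectProduct.inr (Multiplicative.ofAdd (1 : ℤ))) * t :=
      M.isFreeProSigmaCyclic_T.subgroup_comm t ht _ hinr
    rw [map_mul]
    calc M.ι (SemidirectProduct.inl (c 1 * c 2 : PuncturedSurfaceGroup 0 4)⁻¹) *
          M.ι (SemidirectProduct.inr (Multiplicative.ofAdd (1 : ℤ))) * t
        = M.ι (SemidirectProduct.inl (c 1 * c 2 : PuncturedSurfaceGroup 0 4)⁻¹) *
            (M.ι (SemidirectProduct.inr (Multiplicative.ofAdd (1 : ℤ))) * t) := mul_assoc _ _ _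
      _ = M.ι (SemidirectProduct.inl (c 1 * c 2 : PuncturedSurfaceGroup 0 4)⁻¹) *
            (t * M.ι (SemidirectProduct.inr (Multiplicative.ofAdd (1 : ℤ)))) := by rw [← h2]
      _ = t * M.ι (SemidirectProduct.inl (c 1 * c 2 : PuncturedSurfaceGroup 0 4)⁻¹) *
            M.ι (SemidirectProduct.inr (Multiplicative.ofAdd (1 : ℤ))) := by rw [← mul_assoc, ← h1]
      _ = t * (M.ι (SemidirectProduct.inl (c 1 * c 2 : PuncturedSurfaceGroup 0 4)⁻¹) *
            M.ι (SemidirectProduct.inr (Multiplicative.ofAdd (1 : ℤ)))) := mul_assoc _ _ _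
  have hle := M.zpowers_closure_le_centralizer _ t hgen
  exact (Subgroup.mem_centralizer_singleton_iff.mp (hle hu)).symm

/-- **`T · U = W · T = J`** (`ι(inl c₁c₂) = ι(inr 1) · u⁻¹ ∈ T · U` and `u ∈ W · T`).
[cite: MochizukiAbsTopII2013, Prop 1.3 (ii) p.11] -/
theorem T_sup_U_eq_WT : M.T ⊔ M.U = (M.nodeGp).map M.PiG.subtype ⊔ M.T := by
  have hTc : IsClosed ((M.T : Subgroup M.P) : Set M.P) := Subgroup.isClosed_topologicalClosure _
  have hUc : IsClosed ((M.U : Subgroup M.P) : Set M.P) := Subgroup.isClosed_topologicalClosure _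
  have hinr : M.ι (SemidirectProduct.inr (Multiplicative.ofAdd (1 : ℤ))) ∈ M.T :=
    Subgroup.le_topologicalClosure _ ⟨_, ⟨Multiplicative.ofAdd (1 : ℤ), rfl⟩, rfl⟩
  have hu : M.ι (SemidirectProduct.inl (c 1 * c 2 : PuncturedSurfaceGroup 0 4)⁻¹ *
      SemidirectProduct.inr (Multiplicative.ofAdd (1 : ℤ))) ∈ M.U :=
    Subgroup.le_topologicalClosure _ (Subgroup.mem_zpowers _)
  have hnode : M.ι (SemidirectProduct.inl (c 1 * c 2 : PuncturedSurfaceGroup 0 4)) ∈ (M.nodeGp).map M.PiG.subtype := by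
    rw [nodeGp_map_eq]; exact Subgroup.le_topologicalClosure _ (Subgroup.mem_zpowers _)
  apply le_antisymm
  · refine sup_le le_sup_right ?_
    refine Subgroup.topologicalClosure_minimal _ ((Subgroup.zpowers_le).mpr ?_) M.isClosed_WT
    rw [map_mul, map_inv, map_inv]
    exact Subgroup.mul_mem _ (Subgroup.mem_sup_left (Subgroup.inv_mem _ hnode)) (Subgroup.mem_sup_right hinr)
  · refine sup_le ?_ le_sup_left
    rw [nodeGp_map_eq]
    refine Subgroup.topologicalClosure_minimal _ ((Subgroup.zpowers_le).mpr ?_)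
      (M.isClosed_sup_of_commute hTc hUc M.T_commute_U).2
    have : M.ι (SemidirectProduct.inl (c 1 * c 2 : PuncturedSurfaceGroup 0 4)) =
        M.ι (SemidirectProduct.inr (Multiplicative.ofAdd (1 : ℤ))) *
          (M.ι (SemidirectProduct.inl (c 1 * c 2 : PuncturedSurfaceGroup 0 4)⁻¹ *
            SemidirectProduct.inr (Multiplicative.ofAdd (1 : ℤ))))⁻¹ := by
      rw [← map_inv, ← map_mul, mul_inv_rev, map_inv, inv_inv, mul_inv_cancel_left]
    rw [this]
    exact Subgroup.mul_mem _ (Subgroup.mem_sup_left hinr) (Subgroup.inv_mem _ (Subgroup.mem_sup_right hu))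

/-- **`I_{v_A} × I_{v_B} = T × U ⥲ J`** as an internal product. [cite: MochizukiAbsTopII2013, Prop 1.3 (ii) p.11] -/
theorem isInternalProduct_TU : IsInternalProduct M.T M.U ((M.nodeGp).map M.PiG.subtype ⊔ M.T) := by
  refine ⟨le_sup_right, ?_, M.T_commute_U, ?_, M.T_sup_U_eq_WT⟩
  · rw [← M.T_sup_U_eq_WT]; exact le_sup_right
  · have h := (M.T_inf_conj_U 1).1
    rwa [map_one, one_smul] at h

/-! ### Prop 1.3 (ii)′ -/

/-- **[AbsTopII] Prop 1.3 (ii) with the printed branch pair (`Prop_1_3_ii'`) HOLDS at the two-vertex nodal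
datum — at a NON-LOOP node, no hypothesis**: exact sequence `1 → Π_e → I_e → I → 1`, `I_e = Π_e × T ≅ Ẑ^Σ × Ẑ^Σ`,
and for the branch pair `(v_A, v_B)` (conjugating elements `1`): `I_{v_A} × I_{v_B} = T × U ⥲ I_e`, open of index
`1 = i^Σ_e` (abc-iut-w5-d102's `prop_1_3_ii'_of_inputs` over abc-iut-f-069's `IvNode_eq_of_image`).
[cite: MochizukiAbsTopII2013, Prop 1.3 (ii) p.11] -/
theorem prop_1_3_ii'_dpsc (hne : Sigma.Nonempty) (hprime : ∀ p ∈ Sigma, p.Prime) :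
    Literature.AnabelianGeometry.AbsoluteAnabelian.AbsTopII.DPSCIndexData.Prop_1_3_ii' (M.dpsc hne hprime) := by
  refine (M.dpsc hne hprime).prop_1_3_ii'_of_inputs (M.isCommensurablyTerminal_nodeSub hne hprime) fun e => ?_
  have hTc : IsClosed ((M.T : Subgroup M.P) : Set M.P) := Subgroup.isClosed_topologicalClosure _
  refine ⟨(M.nodeGp).map M.PiG.subtype ⊔ M.T, le_sup_left, M.WT_sup_PiG, ⟨(M.nodeGp).map M.PiG.subtype, M.T,
    M.isClosed_W, hTc, M.isFreeProSigmaCyclic_W, M.isFreeProSigmaCyclic_T, M.isInternalProduct_WT⟩, ?_⟩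
  intro v v' _ _ hguard
  rcases M.vert_cases hne hprime v with rfl | rfl <;> rcases M.vert_cases hne hprime v' with rfl | rfl
  · -- diagonal at `v_A`: excluded by the guard (the node is not a loop)
    exfalso
    rcases hguard with h | h
    · exact h rfl
    · exact M.vert_zero_ne_one hne hprime (h ⟨(1 : Fin 2)⟩ (M.nodeAbuts_dpsc hne hprime e _)).symm
  · refine ⟨1, 1, Subgroup.one_mem _, Subgroup.one_mem _, (M.nodeGp).map M.PiG.subtype ⊔ M.T, ?_, le_rfl,
      by rw [Subgroup.subgroupOf_self]; exact isOpen_univ, by rw [Subgroup.relIndex_self]; rfl⟩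
    rw [map_one, one_smul, one_smul, Iv_eq_T, Iv_eq_U]
    exact M.isInternalProduct_TU
  · refine ⟨1, 1, Subgroup.one_mem _, Subgroup.one_mem _, (M.nodeGp).map M.PiG.subtype ⊔ M.T, ?_, le_rfl,
      by rw [Subgroup.subgroupOf_self]; exact isOpen_univ, by rw [Subgroup.relIndex_self]; rfl⟩
    rw [map_one, one_smul, one_smul, Iv_eq_T, Iv_eq_U]
    obtain ⟨h1, h2, h3, h4, h5⟩ := M.isInternalProduct_TU
    exact ⟨h2, h1, fun a ha b hb => (h3 b hb a ha).symm, by rw [inf_comm]; exact h4, by rw [sup_comm]; exact h5⟩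
  · exfalso
    rcases hguard with h | h
    · exact h rfl
    · exact M.vert_zero_ne_one hne hprime (h ⟨(0 : Fin 2)⟩ (M.nodeAbuts_dpsc hne hprime e _))

/-! ### Prop 1.3 (iv)′: trichotomy with two ADJACENT vertices, and «In particular» for every conjugate -/

/-- **[AbsTopII] Prop 1.3 (iv), trichotomy + «In particular» (`Prop13iv'`, F-0276 successor) HOLDS at the
two-vertex nodal datum, no hypothesis**; situation (2) (distinct ADJACENT vertices) occurs, and the «In
particular» clause `I_{v_A} ∩ γ I_{v_B} γ⁻¹ = {1}` holds for EVERY `γ` (two-character lemma).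
[cite: MochizukiAbsTopII2013, Prop 1.3 (iv) p.11] -/
theorem prop13iv'_dpsc (hne : Sigma.Nonempty) (hprime : ∀ p ∈ Sigma, p.Prime) :
    Literature.AnabelianGeometry.AbsoluteAnabelian.DPSCData.Prop13iv' (M.dpsc hne hprime).toDPSCData := by
  refine ⟨fun v v' γ _ _ => ?_, fun v v' γ _ h => ?_⟩
  · by_cases hvv : v = v'
    · exact Or.inl hvv
    · exact Or.inr (Or.inl ⟨hvv, M.adjacent_dpsc hne hprime v v'⟩)
  · by_contra hvv
    apply h
    rcases M.vert_cases hne hprime v with rfl | rfl <;> rcases M.vert_cases hne hprime v' with rfl | rfl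
    · exact absurd rfl hvv
    · rw [Iv_eq_T, Iv_eq_U]; exact (M.T_inf_conj_U γ).1
    · rw [Iv_eq_T, Iv_eq_U]; exact (M.T_inf_conj_U γ).2
    · exact absurd rfl hvv

end Literature.AnabelianGeometry.AbsoluteAnabelian.AbsTopII.TwoTripodNodal.Model

end
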